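import Mathlib
import HarnessLib
import Summits.HubbardSuperconductivity.HubbardSuperconductivity.Theorems.KLProgrammeKLRegimeSplitFermiPointC4Regime

/-!
# Route `KLProgramme` — ENGINE child `KLRegimeEngineV11` (stmt-HubbardSuperconductivity-19823), two-leg stubs: the `C⁴` Fermi-point bounds
# with an EXPLICIT, `c`-FREE constant in the scope of the two-leg slot (cell gate-hubbard-kl, seat p1b g5; E3-CERT-NOTE §5)

`fermiPointLp_C4_of_frameOK` (`…SplitFermiPointC4Regime`) hides its constant behind `∃ D` and lets it depend on the regime constant `c` (through
`A = 2Gfr₀U + 2Gfr₁U² + Gfr₂·c/log 4`).  A re-typed (E3g) majorant must be a function of the slot's arguments `(R, U, N = nScales β)` only.  Since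
`4A ≤ min(Dt_min, 1/5)` in the regime, `min(Dt_min − 2A, 1) ≥ min(Dt_min/2, 1)`, and the bound holds with

  `fermiC4Const R U N := 20·(31104·(24·(4 + 16·A′)·9⁴)⁴ / min(Dt_min/2, 1)⁴)`, `A′ = 1 + Σ_{j<5} (N+1)·Gfr j·uPow j U·4^{2N}`,

`Dt_min` the radial transversality constant of `bandBounds (−1.1) (−0.1)` — spelled out inline below (no definition is introduced):
`norm_iteratedDeriv_fermiPointLp_le_explicit`.  Proofs only.
-/

noncomputable section

namespace Summit.HubbardSuperconductivity.HubbardSuperconductivity.Theorems.PerturbedFermiCurve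

set_option linter.dupNamespace false -- summit = problem name (single-conjunct summit), D-0017

open Real Set Finset
open Literature.MathematicalPhysics.QuantumLattice Literature.MathematicalPhysics.QuantumLattice.BandSectorCounting
open Summit.HubbardSuperconductivity.HubbardSuperconductivity.Theorems.DispersionFlow
open Summit.HubbardSuperconductivity.HubbardSuperconductivity.Theorems.KLRegimeSplit

/-- The analysis window `[-1.1, -0.1]` lies strictly inside the band `(-4, 0)`. -/
theorem window_lo : (-4 : ℝ) < -1.1 := by norm_num
/-- `-1.1 ≤ -0.1`. -/
theorem window_le : (-1.1 : ℝ) ≤ -0.1 := by norm_num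
/-- `-0.1 < 0`. -/
theorem window_hi : (-0.1 : ℝ) < 0 := by norm_num

/-- **THE `C⁴` FERMI-POINT BOUNDS WITH AN EXPLICIT `c`-FREE CONSTANT.**  For every `R` (`Gfr ≥ 0`) there are `c₃, U₀ > 0` such that in the regime
`0 < c ≤ c₃`, `0 < U ≤ U₀`, `klBetaMin ≤ β ≤ e^{c/U²}`, for every `μ ∈ klWindowC` and every `FrameOK R U (nScales β) μ K` frame, `γ = toLp ∘ k_F^K` is `C⁴` and
`‖Dⁱγ(θ)‖ ≤ Dⁱ` (`1 ≤ i ≤ 4`) with the EXPLICIT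
`D = 20·(31104·(24·(4 + 16A′)·9⁴)⁴ / min(Dt_min/2, 1)⁴)`, `A′ = 1 + Σ_{j<5} (nScales β+1)·Gfr j·uPow j U·4^{2·nScales β}`, `Dt_min = (bandBounds …).Dtmin` on `[-1.1,-0.1]`
— a function of `(R, U, nScales β)` only. -/
theorem norm_iteratedDeriv_fermiPointLp_le_explicit (R : RenConsts) (hR : ∀ j, 0 ≤ R.Gfr j) :
    ∃ c₃ : ℝ, 0 < c₃ ∧ ∃ U₀ : ℝ, 0 < U₀ ∧
      ∀ c : ℝ, 0 < c → c ≤ c₃ → ∀ U : ℝ, 0 < U → U ≤ U₀ → ∀ β : ℝ, klBetaMin ≤ β → β ≤ Real.exp (c / U ^ 2) →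
      ∀ μ ∈ klWindowC, ∀ K : TrigPolyC4v, FrameOK R U (nScales β) μ K →
        ContDiff ℝ 4 (fun θ : ℝ => (WithLp.toLp 2 (klFermiPoint μ K θ) : Momentum)) ∧
        ∀ i, 1 ≤ i → i ≤ 4 → ∀ θ : ℝ,
          ‖iteratedDeriv i (fun θ : ℝ => (WithLp.toLp 2 (klFermiPoint μ K θ) : Momentum)) θ‖ ≤
            (20 * (31104 * (24 * (4 + 16 * (1 + ∑ j ∈ range 5, ((nScales β : ℝ) + 1) * R.Gfr j * uPow j U *
              (4 : ℝ) ^ (2 * nScales β))) * 9 ^ 4) ^ 4 /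
              (min ((bandBounds window_lo window_le window_hi).Dtmin / 2) 1) ^ 4)) ^ i := by
  set B := bandBounds window_lo window_le window_hi with hBdef
  have hDt := B.Dtmin_pos
  set κ : ℝ := min B.Dtmin (1 / 5) with hκdef
  have hκ : 0 < κ := lt_min hDt (by norm_num)
  obtain ⟨c₃, hc₃, U₀, hU₀, hthr⟩ := frame_thresholds hR hκ
  refine ⟨c₃, hc₃, U₀, hU₀, ?_⟩
  intro c hc hcle U hU hUle β hβmin hβc μ hμ K hK
  set A := 2 * R.Gfr 0 * |U| + 2 * R.Gfr 1 * U ^ 2 + R.Gfr 2 * (c / Real.log 4) with hAdef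
  set A' := 1 + ∑ j ∈ range 5, ((nScales β : ℝ) + 1) * R.Gfr j * uPow j U * (4 : ℝ) ^ (2 * nScales β) with hA'def
  have h4A : 4 * A ≤ κ := hthr c U hc.le hcle hU hUle
  have hA0 : 0 ≤ A := by
    have h0 := hR 0; have h1 := hR 1; have h2 := hR 2
    have hlog : 0 < Real.log 4 := Real.log_pos (by norm_num)
    positivity
  have hκDt : κ ≤ B.Dtmin := min_le_left _ _
  have hADt : 2 * A < B.Dtmin := by linarith
  have hA20 : A ≤ 1 / 20 := by
    have : κ ≤ 1 / 5 := min_le_right _ _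
    linarith
  have hA'1 : 1 ≤ A' := by
    have hnn : ∀ i ∈ range 5, 0 ≤ ((nScales β : ℝ) + 1) * R.Gfr i * uPow i U * (4 : ℝ) ^ (2 * nScales β) := fun i _ => by
      have := hR i; have := uPow_nonneg i U; positivity
    have := sum_nonneg hnn
    linarith
  have hAf : ∀ p : Momentum, ∀ j ≤ 2, ‖iteratedFDeriv ℝ j (frameShift K) p‖ ≤ A := fun p j hj =>
    norm_iteratedFDeriv_frameShift_le_of_frameOK_regime hR hc.le hβmin hβc hK p hj
  have hAf' : ∀ p : Momentum, ∀ j ≤ 4, ‖iteratedFDeriv ℝ j (frameShift K) p‖ ≤ A' := fun p j hj =>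
    norm_iteratedFDeriv_frameShift_le_frameC4Size hR hK p hj
  obtain ⟨hlo, hhi⟩ := klWindowC_margin hμ hA20
  refine ⟨contDiff_four_fermiPointLp B hAf hADt hlo hhi, fun i hi1 hi4 θ => ?_⟩
  refine (norm_iteratedDeriv_fermiPointLp_le B hAf hADt hAf' hA'1 hlo hhi i hi1 hi4 θ).trans ?_
  -- monotonicity in the transversality floor: `min(Dt_min − 2A, 1) ≥ min(Dt_min/2, 1)`
  have hd' : 0 < min (B.Dtmin / 2) 1 := lt_min (by linarith) one_pos
  have hdd : min (B.Dtmin / 2) 1 ≤ min (B.Dtmin - 2 * A) 1 := min_le_min (by linarith) le_rfl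
  have hX : 0 ≤ 31104 * (24 * (4 + 16 * A') * 9 ^ 4) ^ 4 := by positivity
  have hfrac : 31104 * (24 * (4 + 16 * A') * 9 ^ 4) ^ 4 / (min (B.Dtmin - 2 * A) 1) ^ 4 ≤
      31104 * (24 * (4 + 16 * A') * 9 ^ 4) ^ 4 / (min (B.Dtmin / 2) 1) ^ 4 :=
    div_le_div_of_nonneg_left hX (by positivity) (pow_le_pow_left₀ hd'.le hdd 4)
  exact pow_le_pow_left₀ (by positivity) (by linarith) i

end Summit.HubbardSuperconductivity.HubbardSuperconductivity.Theorems.PerturbedFermiCurve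

end
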